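import Mathlib
import Summits.ValiantsHypothesis.ValiantsHypothesis.Theorems.LacunarySymmetroidMatrixDescartesCensusRealExponentsTwoByTwoLocus

/-!
# `MatrixDescartes` census — `2 × 2` pencils: bracket certificates are complete for every register (fixed support)

HONEST FRAMING.  Object-search cell `pub-symmetroid`, item `DoorA26 = PosRootLawAt 2 6 19`
(stmt-ValiantsHypothesis-19979; OPEN, typed, never asserted) and the cell's `(2,K,B)` registers
`ζ_sym(2,K;d)`; one structure theorem about how such registers can be WITNESSED, deciding nothing.
Nothing here bears on `MatrixDescartes` (stmt-ValiantsHypothesis-18050) or `VP ≠ VNP`.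

* `exists_brackets_of_le_card_posRoots_two` — if some real symmetric `2 × 2` pencil on the INTEGER
  support `d` has at least `N ≥ 1` distinct positive det-roots, then some real symmetric pencil on the
  SAME support (a one-letter perturbation `S₀ ↦ S₀ + εW`) changes the sign of its determinant across
  `n ≥ N` increasing, pairwise disjoint positive brackets `0 < a_i < b_i ≤ a_{i+1}`.  With the IVT row
  `SymmetroidDescartes.le_card_posRoots_of_alternating` (brackets ⇒ roots) this says: **every register
  `ζ_sym(2,K;d) ≥ N` — in particular a hypothetical NINETEEN or TWENTY at `(2,6)` — is certifiable by
  finitely many sign evaluations of ONE symmetric pencil on `d`; even-multiplicity (touching) roots are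
  never needed to attain a register.**  (The real-exponent, persistent form is
  `exists_persistent_brackets_two`, …TwoByTwoLocus; this is its integer-support reading.)

[folklore] Change of variable `x = e^t` on the companion files.
-/

-- `Summit.ValiantsHypothesis.ValiantsHypothesis.…` repeats a component by the D-0017 layout
-- (single-conjunct summit), which the `dupNamespace` linter flags; the name is mandated.
set_option linter.dupNamespace false

namespace Summit.ValiantsHypothesis.ValiantsHypothesis.Theorems.LacunarySymmetroidMatrixDescartes.Census.RealExp

open Finset Polynomial
open scoped BigOperators Matrix
open Summit.ValiantsHypothesis.ValiantsHypothesis.Theorems.SymmetroidDescartes (eval_det_pencil)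

section TwoByTwoBrackets

/-- **Bracket certificates are complete for the `2 × 2` registers (fixed support).**  If some real
symmetric `2 × 2` pencil on the INTEGER support `d` has at least `N ≥ 1` distinct positive det-roots,
then some real symmetric pencil on the SAME support has `n ≥ N` increasing, pairwise disjoint positive
brackets `0 < a_i < b_i ≤ a_{i+1}` across each of which its determinant changes sign. [folklore] -/
theorem exists_brackets_of_le_card_posRoots_two {k N : ℕ} (d : Fin (k + 1) → ℕ)
    (S : Fin (k + 1) → Matrix (Fin 2) (Fin 2) ℝ) (hS : ∀ l, (S l).IsSymm) (hN0 : 0 < N)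
    (hN : N ≤ ((∑ l, (X : ℝ[X]) ^ d l • (S l).map C).det.roots.toFinset.filter (fun x => 0 < x)).card) :
    ∃ S' : Fin (k + 1) → Matrix (Fin 2) (Fin 2) ℝ, (∀ l, (S' l).IsSymm) ∧
      ∃ n : ℕ, N ≤ n ∧ ∃ a b : Fin n → ℝ, (∀ i, 0 < a i) ∧ (∀ i, a i < b i) ∧
        (∀ i j, i < j → b i ≤ a j) ∧ ∀ i,
          ((∑ l, (X : ℝ[X]) ^ d l • (S' l).map C).det.eval (a i)) *
            ((∑ l, (X : ℝ[X]) ^ d l • (S' l).map C).det.eval (b i)) < 0 := by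
  classical
  set P : ℝ[X] := (∑ l, (X : ℝ[X]) ^ d l • (S l).map C).det with hP
  have hP0 : P ≠ 0 := by
    intro h0
    rw [h0, roots_zero, Multiset.toFinset_zero, Finset.filter_empty, Finset.card_empty] at hN
    omega
  set δ : Fin (k + 1) → ℝ := fun l => ((d l : ℕ) : ℝ) with hδ
  have hset : (↑(P.roots.toFinset.filter (fun x => 0 < x)) : Set ℝ) =
      {x : ℝ | 0 < x ∧ (∑ l, (x ^ (δ l)) • S l).det = 0} := by
    ext x
    rw [Finset.coe_filter, Set.mem_setOf_eq, Set.mem_setOf_eq, Multiset.mem_toFinset, mem_roots hP0,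
      IsRoot.def, hP, eval_det_pencil]
    simp only [hδ, Real.rpow_natCast]
    exact and_comm
  have hcount : N ≤ {t : ℝ | (∑ l, Real.exp (δ l * t) • S l).det = 0}.ncard := by
    rw [← ncard_rpow_eq_ncard_exp δ S, ← hset, Set.ncard_coe_finset]; exact hN
  obtain ⟨S', hS', n, hnN, a, b, hab, hdisj, r, hr, hball⟩ :=
    exists_persistent_brackets_two δ S hS hN0 hcount
  have hsign := hball δ (by rw [dist_self]; exact hr)
  have heval : ∀ t, ((∑ l, (X : ℝ[X]) ^ d l • (S' l).map C).det.eval (Real.exp t)) =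
      (∑ l, Real.exp (δ l * t) • S' l).det := by
    intro t
    rw [eval_det_pencil]
    refine congrArg Matrix.det (Finset.sum_congr rfl fun l _ => ?_)
    rw [hδ, ← Real.exp_nat_mul]
  refine ⟨S', hS', n, hnN, fun i => Real.exp (a i), fun i => Real.exp (b i), fun i => Real.exp_pos _,
    fun i => Real.exp_lt_exp.mpr (hab i), fun i j hij => Real.exp_le_exp.mpr (hdisj i j hij), fun i => ?_⟩
  rw [heval, heval]
  exact hsign i

/-- **Registers are attained transversally (`2 × 2`).**  On a fixed integer support `d`, some real
symmetric `2 × 2` pencil has `≥ N` distinct positive det-roots iff some real symmetric `2 × 2` pencil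
changes the sign of its determinant across `≥ N` pairwise disjoint positive brackets (`N ≥ 1`).
[folklore] -/
theorem exists_le_card_posRoots_iff_exists_brackets_two {k N : ℕ} (d : Fin (k + 1) → ℕ) (hN0 : 0 < N) :
    (∃ S : Fin (k + 1) → Matrix (Fin 2) (Fin 2) ℝ, (∀ l, (S l).IsSymm) ∧
      N ≤ ((∑ l, (X : ℝ[X]) ^ d l • (S l).map C).det.roots.toFinset.filter (fun x => 0 < x)).card) ↔
    ∃ S : Fin (k + 1) → Matrix (Fin 2) (Fin 2) ℝ, (∀ l, (S l).IsSymm) ∧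
      ∃ n : ℕ, N ≤ n ∧ ∃ a b : Fin n → ℝ, (∀ i, 0 < a i) ∧ (∀ i, a i < b i) ∧
        (∀ i j, i < j → b i ≤ a j) ∧ ∀ i,
          ((∑ l, (X : ℝ[X]) ^ d l • (S l).map C).det.eval (a i)) *
            ((∑ l, (X : ℝ[X]) ^ d l • (S l).map C).det.eval (b i)) < 0 := by
  classical
  constructor
  · rintro ⟨S, hS, hN⟩
    obtain ⟨S', hS', h⟩ := exists_brackets_of_le_card_posRoots_two d S hS hN0 hN
    exact ⟨S', hS', h⟩
  · rintro ⟨S, hS, n, hnN, a, b, hpos, hab, hdisj, hsign⟩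
    refine ⟨S, hS, hnN.trans ?_⟩
    set P : ℝ[X] := (∑ l, (X : ℝ[X]) ^ d l • (S l).map C).det with hP
    -- one root strictly inside each bracket; the brackets are disjoint
    have hroot : ∀ i, ∃ w ∈ Set.Ioo (a i) (b i), P.eval w = 0 := fun i =>
      exists_zero_of_mul_neg (hab i) P.continuous.continuousOn (hsign i)
    choose w hwmem hw0 using hroot
    have hP0 : P ≠ 0 := by
      rcases Nat.eq_zero_or_pos n with hn | hn
      · omega
      · intro h0
        have := hsign ⟨0, hn⟩
        rw [h0, eval_zero, zero_mul] at this
        exact lt_irrefl _ this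
    have hwmono : StrictMono w := by
      intro i j hij
      have h1 := (hwmem i).2; have h2 := (hwmem j).1; have h3 := hdisj i j hij
      linarith
    have hsub : univ.image w ⊆ P.roots.toFinset.filter (fun x => 0 < x) := by
      intro x hx
      rw [Finset.mem_image] at hx
      obtain ⟨i, -, rfl⟩ := hx
      rw [Finset.mem_filter, Multiset.mem_toFinset, mem_roots hP0, IsRoot.def]
      exact ⟨hw0 i, (hpos i).trans (hwmem i).1⟩
    have hcard := Finset.card_le_card hsub
    rw [Finset.card_image_of_injective _ hwmono.injective, Finset.card_univ, Fintype.card_fin] at hcard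
    exact hcard

end TwoByTwoBrackets

end Summit.ValiantsHypothesis.ValiantsHypothesis.Theorems.LacunarySymmetroidMatrixDescartes.Census.RealExp
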